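import Summits.CriticalPhenomena.PercolationContinuityZ3.Theorems.PercNearOneGluingAdditiveGluingTwoStepGlue
import HarnessLib

/-!
# Crux `PercNearOneGluing.AdditiveGluing` (stmt-CriticalPhenomena-4576): the registered three-relay stub from the registered
# five-point inequality `stub_v3prime_dp`

Support file (`--supports stmt-CriticalPhenomena-4576`; task png-dp-al5).  No definitions, no named facts, no sorries.

`threeRelaysFullTieAllBad_of_v3prime`: the statement of the registered kernel stub `stub_v3prime_dp` ((V3′), "Kozma–Nitzan Lemma 4
with a weighted spectator", hypothesis-free; memo TWOSTEP-GLUE.md on the item) implies the statement of the official skeleton's stub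
`stub_threeRelaysFullTieAllBad_pl` (three relays at the full tie, all-bad corner) VERBATIM — in fact without using the tie, the
non-degeneracy or the all-bad hypotheses: (V3′) for the pair `{a₁,a₂}` with spectator `a₃` and `θ = 1 − t ≤ τ₁, τ₂, τ₃` gives CAG(3)
(`twoStep_cag3_of_v3prime`), whence the E-form.  So a proof of `stub_v3prime_dp` closes stub 1 of skeleton v14 mechanically.
[cite: KozmaNitzan2024, Question 7 (p. 36), Lemma 4 (p. 9)]
-/

namespace Summit.CriticalPhenomena.PercolationContinuityZ3.Theorems

open MeasureTheory Set Literature.Probability.LatticeModels Literature.Probability.Percolation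

noncomputable section
open Classical

/-- **`stub_v3prime_dp` ⟹ `stub_threeRelaysFullTieAllBad_pl`** (both statements verbatim; the tie, non-degeneracy and all-bad
hypotheses of the latter are not used). [cite: KozmaNitzan2024, Question 7 (p. 36)] -/
theorem threeRelaysFullTieAllBad_of_v3prime
    (hV3 : ∀ (n : ℕ) (w : Sym2 (Fin n) → unitInterval) (o b a₁ a₂ c : Fin n), ((Literature.Probability.LatticeModels.prodBernoulli w).real ((Literature.Probability.Percolation.openConn c a₁)ᶜ ∩ (Literature.Probability.Percolation.openConn c a₂)ᶜ ∩ (Literature.Probability.Percolation.openConn o a₁ ∪ Literature.Probability.Percolation.openConn o a₂)) + (Literature.Probability.LatticeModels.prodBernoulli w).real ((Literature.Probability.Percolation.openConn c a₁)ᶜ ∩ (Literature.Probability.Percolation.openConn c a₂)ᶜ ∩ Literature.Probability.Percolation.openConn o c)) * (Literature.Probability.LatticeModels.prodBernoulli w).real ((Literature.Probability.Percolation.openConn o b)ᶜ ∩ (Literature.Probability.Percolation.openConn o a₁ ∪ Literature.Probability.Percolation.openConn o a₂) ∩ (Literature.Probability.Percolation.openConn a₁ b ∪ Literature.Probability.Percolation.openConn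 a₂ b)) ≤ (Literature.Probability.LatticeModels.prodBernoulli w).real ((Literature.Probability.Percolation.openConn c a₁)ᶜ ∩ (Literature.Probability.Percolation.openConn c a₂)ᶜ ∩ (Literature.Probability.Percolation.openConn o a₁ ∪ Literature.Probability.Percolation.openConn o a₂)) * ((Literature.Probability.LatticeModels.prodBernoulli w).real (Literature.Probability.Percolation.openConn a₁ b ∪ Literature.Probability.Percolation.openConn a₂ b) - min ((Literature.Probability.LatticeModels.prodBernoulli w).real (Literature.Probability.Percolation.openConn a₁ b)) ((Literature.Probability.LatticeModels.prodBernoulli w).real (Literature.Probability.Percolation.openConn a₂ b)) + (Literature.Probability.LatticeModels.prodBernoulli w).real ((Literature.Probability.Percolation.openConn o a₁ ∪ Literature.Probability.Percolation.openConn o a₂ ∪ Literature.Probability.Percolation.openConn o c)ᶜ ∩ Literature.Probability.Percolation.openConn c b ∩ (Literature.Probability.Percolation.openConn a₁ b ∪ Literature.Probability.Percolation.openConn a₂ b)ᶜ)) + (Literature.Probability.LatticeModels.prodBernoulli w).real ((Literature.Probability.Percolation.openConn c a₁)ᶜ ∩ (Literature.Probability.Percolation.openConn c a₂)ᶜ ∩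 Literature.Probability.Percolation.openConn o c) * ((Literature.Probability.LatticeModels.prodBernoulli w).real ((Literature.Probability.Percolation.openConn c b)ᶜ ∩ (Literature.Probability.Percolation.openConn c a₁ ∪ Literature.Probability.Percolation.openConn c a₂) ∩ (Literature.Probability.Percolation.openConn a₁ b ∪ Literature.Probability.Percolation.openConn a₂ b)) + (Literature.Probability.LatticeModels.prodBernoulli w).real ((Literature.Probability.Percolation.openConn o a₁ ∪ Literature.Probability.Percolation.openConn o a₂ ∪ Literature.Probability.Percolation.openConn o c)ᶜ ∩ (Literature.Probability.Percolation.openConn a₁ b ∪ Literature.Probability.Percolation.openConn a₂ b) ∩ (Literature.Probability.Percolation.openConn c b)ᶜ ∩ ((Literature.Probability.Percolation.openConn c a₁)ᶜ ∩ (Literature.Probability.Percolation.openConn c a₂)ᶜ)))) :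
    ∀ (n : ℕ) (w : Sym2 (Fin n) → unitInterval) (o b a₁ a₂ a₃ : Fin n) (t : ℝ), a₁ ≠ a₂ → a₁ ≠ a₃ → a₂ ≠ a₃ → 1 - t ≤ (prodBernoulli w).real (openConn a₃ b) → (prodBernoulli w).real (openConn a₃ b) ≤ (prodBernoulli w).real (openConn a₁ b) → (prodBernoulli w).real (openConn a₃ b) ≤ (prodBernoulli w).real (openConn a₂ b) → (prodBernoulli w).real (openConn a₁ b) ≤ (prodBernoulli w).real (openConn a₃ b) → (prodBernoulli w).real (openConn a₂ b) ≤ (prodBernoulli w).real (openConn a₃ b) → 0 < (prodBernoulli w).real ((openConn a₁ a₂)ᶜ ∩ (openConn a₁ a₃)ᶜ : Set (BondConfig (Fin n))) → 0 < (prodBernoulli w).real ((openConn a₂ a₁)ᶜ ∩ (openConn a₂ a₃)ᶜ : Set (BondConfig (Fin n))) → 0 < (prodBernoulli w).real ((openConn a₁ a₃)ᶜ ∩ (openConn a₂ a₃)ᶜ : Set (BondConfig (Fin n))) → (prodBernoulli w).real (openConn b a₂ ∩ openConn b a₃ ∩ (openConn b a₁)ᶜ) < (prodBernoulli w).real (openConn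 b a₁ ∩ (openConn b a₂)ᶜ ∩ (openConn b a₃)ᶜ) → (prodBernoulli w).real (openConn b a₁ ∩ openConn b a₃ ∩ (openConn b a₂)ᶜ) < (prodBernoulli w).real (openConn b a₂ ∩ (openConn b a₁)ᶜ ∩ (openConn b a₃)ᶜ) → (prodBernoulli w).real (openConn b a₁ ∩ openConn b a₂ ∩ (openConn b a₃)ᶜ) < (prodBernoulli w).real (openConn b a₃ ∩ (openConn b a₁)ᶜ ∩ (openConn b a₂)ᶜ) → (prodBernoulli w).real ((openConn o a₁ ∪ openConn o a₂ ∪ openConn o a₃) \ openConn o b) ≤ t := by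
  intro n w o b a₁ a₂ a₃ t h12 h13 _ ht3 h31 h32 _ _ _ _ _ _ _ _
  have hθ1 : 1 - t ≤ (prodBernoulli w).real (openConn a₁ b) := ht3.trans h31
  have hθ2 : 1 - t ≤ (prodBernoulli w).real (openConn a₂ b) := ht3.trans h32
  have hcag := twoStep_cag3_of_v3prime w o b a₁ a₂ a₃ h12 h13 (1 - t) hθ1 hθ2 ht3 (hV3 n w o b a₁ a₂ a₃)
  have hm : ∀ s : Set (BondConfig (Fin n)), MeasurableSet s := fun _ => MeasurableSet.of_discrete
  set μ := prodBernoulli w with hμ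
  set oA : Set (BondConfig (Fin n)) := openConn o a₁ ∪ openConn o a₂ ∪ openConn o a₃ with hoA
  set Ab : Set (BondConfig (Fin n)) := openConn a₁ b ∪ openConn a₂ b ∪ openConn a₃ b with hAb
  have h1 := measureReal_inter_add_sdiff (μ := μ) (s := oA \ openConn o b) (hm Ab)
  have e1 : (oA \ openConn o b) ∩ Ab = oA ∩ (openConn o b)ᶜ ∩ Ab := by
    rw [Set.sdiff_eq]
  have h2 : μ.real ((oA \ openConn o b) \ Ab) ≤ μ.real Abᶜ :=
    measureReal_mono (fun ω hω => hω.2) (measure_ne_top _ _)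
  have h3 : μ.real Abᶜ = 1 - μ.real Ab := probReal_compl_eq_one_sub (hm _)
  rw [e1] at h1
  linarith

end

end Summit.CriticalPhenomena.PercolationContinuityZ3.Theorems
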